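import Literature.NumberTheory.EllipticCurves.BSDHeegnerPointsSignProofs
import Literature.NumberTheory.EllipticCurves.BSDRootNumberProofs
import Literature.NumberTheory.EllipticCurves.CuspFormTwistFrickeProofs
import HarnessLib

/-!
# `ord_{s=1} L(E/K, s)` is odd: the sign of `E` over `K` from the twisted newform

Second proof file of `Literature/NumberTheory/EllipticCurves/BSDHeegnerPoints.lean` for the named
fact `Literature.NumberTheory.EllipticCurves.one_le_analyticRankEK W N K` (Gross 1984, §5: under the
Heegner hypothesis `L(E/K, s) = L(E, s) L(E^{(d_K)}, s)` vanishes to odd order at `s = 1`). The first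
file (`BSDHeegnerPointsSignProofs`) reduced the fact to three inputs: entire continuation, parity, and
the sign `w(E) w(E^{(d_K)}) = −1`. Here the last two inputs are *proved* from the modular form of `E`,
so that the fact is reduced to the Modularity Theorem (`exists_isNewformOf`) and the purely
arithmetic description of the twist by the Kronecker character of `K`:

Let `f ∈ S₂(Γ₀(N))` be the newform of `W` (`IsNewformOf W f`), `χ` a primitive quadratic Dirichlet
character mod `m` with `(m, N) = 1`, and suppose `aₙ(W^{(d_K)}) = χ(n) aₙ(W)` for all `n ≥ 1` and
`χ(−1) χ(N) = −1`. Then (`odd_analyticRankEK_of_isNewformOf_of_cuspCoeff_twist`)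
`ord_{s=1} L(E/K, s)` is odd, in particular `≥ 1`. Proof (Gross 1984, §5; Gross–Zagier 1986, IV
(0.1)–(0.2); Darmon 2004, §3.6, Thm. 3.15 and Thm. 3.17):

1. `w_N f = ε f` with `ε = ±1` (Atkin–Lehner 1970, Thm. 3; the tree's
   `IsNewform0.exists_frickeInvolution_eq_smul_holds`), and the twist `g = f_χ ∈ S₂(Γ₀(Nm²))`
   (Shimura 1971, Prop. 3.64; `charTwist`) has `aₙ(g) = χ(n) aₙ(f) = aₙ(W^{(d_K)})` and
   `w_{Nm²} g = χ(−1) χ(N) ε g = −ε g` (Atkin–Lehner 1970, §6; `frickeInvolution_charTwist_of_eq_smul`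
   of `CuspFormTwistFrickeProofs`);
2. Hecke's functional equations (`exists_completedCuspFormL_functional_equation_holds`):
   `Λ_f(2 − s) = −ε Λ_f(s)` and `Λ_g(2 − s) = ε Λ_g(s)` for the entire continuations of
   `N^{s/2}(2π)^{-s}Γ(s)L(f, s)` and `(Nm²)^{s/2}(2π)^{-s}Γ(s)L(g, s)`;
3. `Λ_f`, `Λ_g` continue the completed `L`-functions of `W`, `W^{(d_K)}` at levels `N`, `Nm²`
   (coefficientwise agreement and Rankin's bound; `mem_completedLContinuations_of_cuspCoeff_eq`), so
   both `L`-functions are entire and `−ε = (−1)^{r}`, `ε = (−1)^{r'}` for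
   `r = ord_{s=1} L(W, s)`, `r' = ord_{s=1} L(W^{(d_K)}, s)` (the level-general form
   `eq_neg_one_pow_analyticRank_of_mem_completedLContinuations_of_ne_zero` of the tree's parity lemma,
   Silverman *AEC* C.16, Thm. 16.3 and remark);
4. hence `(−1)^{r + r'} = −ε² = −1`, `r + r' = ord_{s=1} L(E/K, s)` is odd.

The remaining arithmetic input — the Kronecker character `χ = χ_{d_K}` mod `m = |d_K|` with
`aₙ(W^{(d_K)}) = χ(n) aₙ(W)`, `χ(−1) = −1` (`K` imaginary) and `χ(N) = 1` (Heegner hypothesis: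
every `p ∣ N` splits) — is isolated as the hypothesis of
`one_le_analyticRankEK_of_exists_isNewformOf_of_twistCharacter`, which gives the named fact from
`exists_isNewformOf` and that input. Everything in this file is proved; no named facts are
introduced (D-0026).

## References

* [Gross1984] B. H. Gross, *Heegner points on `X₀(N)`*, in *Modular Forms* (R. A. Rankin, ed.),
  Ellis Horwood (1984), 87–105, §5.
* [GrossZagier1986] B. H. Gross, D. B. Zagier, *Heegner points and derivatives of `L`-series*,
  Invent. Math. 84 (1986), 225–320, IV.
* [Darmon2004] H. Darmon, *Rational points on modular elliptic curves*, CBMS 101, AMS (2004), §3.6,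
  Thm. 3.15, Thm. 3.17 and the paragraph following Conj. 3.19.
* [AtkinLehner1970] A. O. L. Atkin, J. Lehner, *Hecke operators on `Γ₀(m)`*, Math. Ann. 185 (1970),
  Thm. 3 and §6.
* [SilvermanAEC2009] J. H. Silverman, *The Arithmetic of Elliptic Curves*, 2nd ed., App. C §16,
  Thm. C.16.3.
-/

noncomputable section

open scoped Classical MatrixGroups ModularForm

open Complex Filter Topology CongruenceSubgroup Literature.NumberTheory.EllipticCurves.ModularForms

universe u

/-! ### Level-general parity: the sign of a functional equation at any level is `(−1)^{r_an}` -/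

namespace WeierstrassCurve

variable {W : WeierstrassCurve ℚ}

/-- **Order of vanishing at the centre, any level.** For an elliptic `W / ℚ` with entire
`L`-function, an entire continuation `Λ` of `M^{s/2}(2π)^{-s}Γ(s)L(W, s)` from `re s > 3/2`
(`Λ ∈ W.completedLContinuations M`, `M ≠ 0`) vanishes at `s = 1` to order exactly
`r_an = ord_{s=1} L(W, s)` (the archimedean factor is a holomorphic unit at `1`). The tree's
`analyticOrderAt_completedLContinuation_one` is the case `M = N_W`; the proof is the same
(Silverman, *AEC* C.16). [cite: SilvermanAEC2009, App. C §16] -/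
theorem analyticOrderAt_one_of_mem_completedLContinuations [W.IsElliptic] {M : ℕ} (hM : M ≠ 0)
    (hE : W.HasEntireLFunction) {Λ : ℂ → ℂ} (hΛ : Λ ∈ W.completedLContinuations M) :
    analyticOrderAt Λ 1 = W.analyticRank := by
  have hUo : IsOpen {s : ℂ | 0 < s.re} := isOpen_lt continuous_const continuous_re
  have h1 : (1 : ℂ) ∈ {s : ℂ | 0 < s.re} := by simp
  set h : ℂ → ℂ := fun s ↦
    (M : ℂ) ^ (s / 2) * (2 * Real.pi : ℂ) ^ (-s) * Complex.Gamma s with hdef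
  have hev : Λ =ᶠ[𝓝 1] fun s ↦ h s * W.entireLFunction s := by
    filter_upwards [hUo.mem_nhds h1] with s hs
    exact W.completedLContinuation_eqOn_of_re_pos hE hM hΛ hs
  rw [analyticOrderAt_congr hev, W.analyticRank_eq_analyticOrderAt hE]
  have hh : AnalyticAt ℂ h 1 :=
    (DifferentiableOn.analyticAt (s := {s : ℂ | 0 < s.re})
      (fun s hs ↦ (differentiableAt_archFactor hM hs).differentiableWithinAt) (hUo.mem_nhds h1))
  have hL : AnalyticAt ℂ W.entireLFunction 1 := (W.differentiable_entireLFunction hE).analyticAt 1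
  have hh0 : analyticOrderAt h 1 = 0 :=
    hh.analyticOrderAt_eq_zero.mpr (archFactor_ne_zero hM (by simp))
  have := analyticOrderAt_mul hh hL
  rw [hh0, zero_add] at this
  exact this

/-- **The sign of a functional equation is `(−1)^{r_an}`, at any level.** If `Λ` is an entire
continuation of the completed `L`-function of an elliptic `W / ℚ` at some level `M ≥ 1` and
`Λ(2 − s) = ε Λ(s)` for all `s` (`ε : ℂ`), then `ε = (−1)^{ord_{s=1} L(W, s)}`. The tree's
`eq_neg_one_pow_analyticRank_of_mem_completedLContinuations` is the case `M = N_W`; the level only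
enters through the holomorphic unit `M^{s/2}` (Silverman, *AEC* C.16, Thm. 16.3 and the remark
following it; Birch–Swinnerton-Dyer 1965, §7). [cite: SilvermanAEC2009, C.16 Thm. 16.3 and remark, p. 451] -/
theorem eq_neg_one_pow_analyticRank_of_mem_completedLContinuations_of_ne_zero [W.IsElliptic]
    {M : ℕ} [NeZero M] {Λ : ℂ → ℂ} (hΛ : Λ ∈ W.completedLContinuations M) {ε : ℂ}
    (hfe : ∀ s : ℂ, Λ (2 - s) = ε * Λ s) : ε = (-1) ^ W.analyticRank := by
  have hE : W.HasEntireLFunction := hasEntireLFunction_of_mem_completedLContinuations hΛ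
  have hGan : AnalyticAt ℂ (fun t : ℂ ↦ Λ (1 + t)) 0 :=
    (hΛ.1.analyticAt (1 + 0)).comp_of_eq (analyticAt_const.add analyticAt_id) rfl
  have hGord : analyticOrderAt (fun t : ℂ ↦ Λ (1 + t)) 0 = W.analyticRank := by
    have hg : AnalyticAt ℂ (fun t : ℂ ↦ 1 + t) 0 := analyticAt_const.add analyticAt_id
    have hg' : deriv (fun t : ℂ ↦ 1 + t) 0 ≠ 0 := by
      rw [deriv_const_add, deriv_id'']
      exact one_ne_zero
    have hcomp := analyticOrderAt_comp_of_deriv_ne_zero (f := Λ) hg hg'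
    simp only [Function.comp_def, add_zero] at hcomp
    rw [hcomp]
    exact analyticOrderAt_one_of_mem_completedLContinuations (NeZero.ne M) hE hΛ
  have hGfe : ∀ t : ℂ, Λ (1 + -t) = ε * Λ (1 + t) := fun t ↦ by
    rw [← hfe (1 + t)]
    congr 1
    ring
  exact (Literature.NumberTheory.EllipticCurves.neg_one_pow_eq_of_comp_neg_eq_mul hGan hGord hGfe).symm

end WeierstrassCurve

/-! ### A cusp form with the Dirichlet coefficients of a curve continues its `L`-function

The tree proves this for `IsNewformOf W f` (`IsNewformOf.hasEntireLFunction`,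
`IsNewformOf.completedLFunction_eq_holds`); only the coefficientwise agreement `aₙ(g) = aₙ(V)` is
used there, and the twisted form `f_χ` is not known to be a newform, so the statements are redone
under that hypothesis alone. -/

namespace Literature.NumberTheory.EllipticCurves.ModularForms

variable {M : ℕ} [NeZero M] {V : WeierstrassCurve ℚ} {g : CuspForm (Gamma0 M) 2}

omit [NeZero M] in
/-- `aₙ(g) = aₙ(V)` for all `n` gives `L(g, s) = L(V, s)` as `L`-series. [folklore] -/
theorem cuspFormLSeries_eq_of_cuspCoeff_eq (hg : ∀ n : ℕ, cuspCoeff g n = (V.LFunction n : ℂ))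
    (s : ℂ) : cuspFormLSeries g s = V.LSeries s := by
  unfold cuspFormLSeries WeierstrassCurve.LSeries
  congr 1
  funext n
  exact hg n

/-- A weight-`2` cusp form on `Γ₀(M)` with the Dirichlet coefficients of `V` makes `L(V, s)` entire:
Hecke's continuation of `L(g, s)` agrees with the series on `re s > 3/2` by Rankin's bound
(`exists_differentiable_eq_cuspFormLSeries_of_lt_re`; Diamond–Shurman Thm. 5.10.2). [cite: DiamondShurman2005, Thm. 5.10.2] -/
theorem hasEntireLFunction_of_cuspCoeff_eq (hg : ∀ n : ℕ, cuspCoeff g n = (V.LFunction n : ℂ)) :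
    V.HasEntireLFunction := by
  obtain ⟨L, hL, hLeq⟩ :=
    exists_differentiable_eq_cuspFormLSeries_of_lt_re (strictWidthInfty_Gamma0 M) g
  refine ⟨L, hL, fun s hs ↦ ?_⟩
  rw [← cuspFormLSeries_eq_of_cuspCoeff_eq hg]
  exact hLeq s (by push_cast; linarith)

/-- Under `aₙ(g) = aₙ(V)`: `L_entire(V, ·) = c_M⁻¹ · Λ` for the entire continuation `Λ` of
`Λ_M(g, s)` (both entire, equal on `re s > 2`; Diamond–Shurman Thm. 5.10.2). [folklore] -/
theorem entireLFunction_eq_invGammaFactor_mul_of_cuspCoeff_eq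
    (hg : ∀ n : ℕ, cuspCoeff g n = (V.LFunction n : ℂ)) {Λ : ℂ → ℂ}
    (hΛ : Λ ∈ completedCuspFormLContinuations M g) :
    V.entireLFunction =
      (fun s : ℂ ↦ (M : ℂ) ^ (-(s / 2)) * (2 * Real.pi : ℂ) ^ s * (Complex.Gamma s)⁻¹) * Λ := by
  obtain ⟨hdiff, heq⟩ := differentiable_invGammaFactor_mul hΛ
  have hW : V.HasEntireLFunction := hasEntireLFunction_of_cuspCoeff_eq hg
  refine AnalyticOnNhd.eq_of_eventuallyEq (z₀ := (3 : ℂ))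
    ((V.differentiable_entireLFunction hW).differentiableOn.analyticOnNhd isOpen_univ)
    (hdiff.differentiableOn.analyticOnNhd isOpen_univ) ?_
  have hopen : IsOpen {s : ℂ | (2 : ℝ) < s.re} := isOpen_lt continuous_const Complex.continuous_re
  filter_upwards [hopen.mem_nhds (show (2 : ℝ) < (3 : ℂ).re by norm_num)] with s hs
  have hs' : ((2 : ℤ) : ℝ) / 2 + 1 < s.re := by push_cast; linarith [hs]
  rw [heq s hs' (by linarith), cuspFormLSeries_eq_of_cuspCoeff_eq hg,
    V.entireLFunction_eq_LSeries hW (by linarith)]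

/-- Under `aₙ(g) = aₙ(V)`: the entire continuation `Λ` of `Λ_M(g, s)` is an entire continuation of
the completed `L`-function `M^{s/2}(2π)^{-s}Γ(s)L(V, s)` of `V` at level `M`
(`Λ ∈ V.completedLContinuations M`; Diamond–Shurman Thm. 5.10.2 with §8.8). [cite: DiamondShurman2005, Thm. 5.10.2] -/
theorem mem_completedLContinuations_of_cuspCoeff_eq
    (hg : ∀ n : ℕ, cuspCoeff g n = (V.LFunction n : ℂ)) {Λ : ℂ → ℂ}
    (hΛ : Λ ∈ completedCuspFormLContinuations M g) : Λ ∈ V.completedLContinuations M := by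
  refine ⟨hΛ.1, fun s hs ↦ ?_⟩
  have hN : (M : ℂ) ≠ 0 := Nat.cast_ne_zero.mpr (NeZero.ne M)
  have h2π : (2 * Real.pi : ℂ) ≠ 0 := by exact_mod_cast (mul_pos two_pos Real.pi_pos).ne'
  have hΓ : Complex.Gamma s ≠ 0 := Complex.Gamma_ne_zero_of_re_pos (by linarith)
  unfold WeierstrassCurve.completedLFunction
  rw [entireLFunction_eq_invGammaFactor_mul_of_cuspCoeff_eq hg hΛ, Pi.mul_apply]
  symm
  calc (M : ℂ) ^ (s / 2) * (2 * Real.pi : ℂ) ^ (-s) * Complex.Gamma s *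
        ((M : ℂ) ^ (-(s / 2)) * (2 * Real.pi : ℂ) ^ s * (Complex.Gamma s)⁻¹ * Λ s)
      = ((M : ℂ) ^ (s / 2) * (M : ℂ) ^ (-(s / 2))) * ((2 * Real.pi : ℂ) ^ (-s) *
          (2 * Real.pi : ℂ) ^ s) * (Complex.Gamma s * (Complex.Gamma s)⁻¹) * Λ s := by ring
    _ = Λ s := by
      rw [← cpow_add _ _ hN, ← cpow_add _ _ h2π, mul_inv_cancel₀ hΓ, add_neg_cancel,
        neg_add_cancel, cpow_zero, cpow_zero]
      ring

end Literature.NumberTheory.EllipticCurves.ModularForms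

/-! ### The sign of `E` over `K` and the odd order of vanishing -/

namespace Literature.NumberTheory.EllipticCurves

open WeierstrassCurve

variable (W : WeierstrassCurve ℚ) (N : ℕ) [NeZero N] (K : Type u) [Field K] [NumberField K]

/-- **`ord_{s=1} L(E/K, s)` is odd** (Gross 1984, §5; Gross–Zagier 1986, IV; Darmon 2004, §3.6,
Thm. 3.15 and Thm. 3.17), from the newform and a twisting character. Let `f ∈ S₂(Γ₀(N))` be the
newform of the elliptic curve `W / ℚ` (`IsNewformOf W f`), and `χ` a primitive quadratic Dirichlet
character mod `m`, `(m, N) = 1`, such that the quadratic twist `W^{(d_K)}` has Dirichlet coefficients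
`aₙ(W^{(d_K)}) = χ(n) aₙ(W)` (`n ≥ 1`) and `χ(−1) χ(N) = −1`. Then `ord_{s=1} L(W, s) L(W^{(d_K)}, s)`
is odd: with `w_N f = ε f` (Atkin–Lehner), the twist `f_χ ∈ S₂(Γ₀(Nm²))` has the coefficients of
`W^{(d_K)}` and `w_{Nm²} f_χ = χ(−N) ε f_χ = −ε f_χ`, so Hecke's functional equations have signs
`−ε` for `L(W, s)` and `+ε` for `L(W^{(d_K)}, s)`, whence `(−1)^{r} = −ε`, `(−1)^{r'} = ε` and
`r + r'` is odd. [cite: Gross1984, §5] [cite: Darmon2004, §3.6, Thm. 3.15 and Thm. 3.17] -/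
theorem odd_analyticRankEK_of_isNewformOf_of_cuspCoeff_twist [W.IsElliptic]
    {f : CuspForm (Gamma0 N) 2} (hf : IsNewformOf W f) {m : ℕ} [NeZero m] (hNm : N.Coprime m)
    {χ : DirichletCharacter ℂ m} (hχ : χ.IsQuadratic) (hprim : χ.IsPrimitive)
    (hcoeff : ∀ n : ℕ, ((W.quadraticTwist (NumberField.discr K : ℚ)).LFunction n : ℂ) =
      χ n * (W.LFunction n : ℂ))
    (hsign : χ (-1) * χ N = -1) : Odd (analyticRankEK W K) := by
  have hd : (NumberField.discr K : ℚ) ≠ 0 := by exact_mod_cast NumberField.discr_ne_zero K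
  haveI := W.isElliptic_quadraticTwist hd
  set W' := W.quadraticTwist (NumberField.discr K : ℚ) with hW'
  -- the newform is a `w_N`-eigenvector with eigenvalue `ε = ±1`
  obtain ⟨ε, hε1, hfeig⟩ := IsNewform0.exists_frickeInvolution_eq_smul_holds hf.1
  -- the twisted form has the coefficients of `W'` and `w_{Nm²}`-eigenvalue `-ε`
  set g := charTwist (N * m ^ 2) (dvd_mul_right N (m ^ 2)) (dvd_mul_left (m ^ 2) N) hχ f with hgdef
  have hgcoeff : ∀ n : ℕ, cuspCoeff g n = (W'.LFunction n : ℂ) := fun n ↦ by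
    rw [hgdef, cuspCoeff_charTwist _ _ _ hχ hprim f n, hf.2 n, hcoeff n]
  have hgeig : frickeInvolution (N * m ^ 2) 2 g = (-ε) • g := by
    rw [hgdef, frickeInvolution_charTwist_of_eq_smul hNm hχ hfeig, hsign, neg_one_mul]
  -- Hecke's functional equations for `f` and `g`
  obtain ⟨Λf, hΛf, hfef⟩ := exists_functional_equation_of_frickeInvolution_eq_smul
    (exists_completedCuspFormL_functional_equation_holds N 2) hfeig
  obtain ⟨Λg, hΛg, hfeg⟩ := exists_functional_equation_of_frickeInvolution_eq_smul
    (exists_completedCuspFormL_functional_equation_holds (N * m ^ 2) 2) hgeig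
  have hI : Complex.I ^ (2 : ℤ) = -1 := by rw [zpow_two, Complex.I_mul_I]
  have h2 : ((2 : ℤ) : ℂ) = 2 := by norm_num
  -- `Λf`, `Λg` continue the completed `L`-functions of `W`, `W'`
  have hΛfW : Λf ∈ W.completedLContinuations N := mem_completedLContinuations_of_cuspCoeff_eq hf.2 hΛf
  have hΛgW : Λg ∈ W'.completedLContinuations (N * m ^ 2) :=
    mem_completedLContinuations_of_cuspCoeff_eq hgcoeff hΛg
  -- signs are `(−1)^{r}`, `(−1)^{r'}`
  have hpf : -ε = (-1) ^ W.analyticRank := by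
    refine eq_neg_one_pow_analyticRank_of_mem_completedLContinuations_of_ne_zero hΛfW fun s ↦ ?_
    have h := hfef (2 - s)
    rw [hI, h2, sub_sub_cancel] at h
    rw [h]
    ring
  have hpg : ε = (-1) ^ W'.analyticRank := by
    refine eq_neg_one_pow_analyticRank_of_mem_completedLContinuations_of_ne_zero hΛgW fun s ↦ ?_
    have h := hfeg (2 - s)
    rw [hI, h2, sub_sub_cancel] at h
    rw [h]
    ring
  have hε2 : ε * ε = 1 := by rcases hε1 with rfl | rfl <;> norm_num
  have hE : W.HasEntireLFunction := hasEntireLFunction_of_mem_completedLContinuations hΛfW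
  have hE' : W'.HasEntireLFunction := hasEntireLFunction_of_mem_completedLContinuations hΛgW
  rw [analyticRankEK_eq_add_of_hasEntireLFunction W K hE hE', ← Nat.not_even_iff_odd]
  intro heven
  have h1 : ((-1 : ℂ)) ^ (W.analyticRank + W'.analyticRank) = 1 := heven.neg_one_pow
  rw [pow_add, ← hpf, ← hpg] at h1
  have h0 : (2 : ℂ) = 0 := by linear_combination -h1 - hε2
  norm_num at h0

/-- **`L(E/K, 1) = 0`**, i.e. `1 ≤ ord_{s=1} L(E/K, s)`, under the hypotheses of
`odd_analyticRankEK_of_isNewformOf_of_cuspCoeff_twist` (an odd number is positive; Gross 1984, §5;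
Darmon 2004, §3.6, (3.16)–(3.17)). [cite: Gross1984, §5] -/
theorem one_le_analyticRankEK_of_isNewformOf_of_cuspCoeff_twist [W.IsElliptic]
    {f : CuspForm (Gamma0 N) 2} (hf : IsNewformOf W f) {m : ℕ} [NeZero m] (hNm : N.Coprime m)
    {χ : DirichletCharacter ℂ m} (hχ : χ.IsQuadratic) (hprim : χ.IsPrimitive)
    (hcoeff : ∀ n : ℕ, ((W.quadraticTwist (NumberField.discr K : ℚ)).LFunction n : ℂ) =
      χ n * (W.LFunction n : ℂ))
    (hsign : χ (-1) * χ N = -1) : 1 ≤ analyticRankEK W K :=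
  (odd_analyticRankEK_of_isNewformOf_of_cuspCoeff_twist W N K hf hNm hχ hprim hcoeff hsign).pos

omit [NeZero N] in
/-- **The named fact `one_le_analyticRankEK W N K` from modularity and the Kronecker character.**
Assume the Modularity Theorem (`exists_isNewformOf`: every elliptic `E / ℚ` has a newform
`f ∈ S₂(Γ₀(N_E))` with `aₙ(f) = aₙ(E)`; Breuil–Conrad–Diamond–Taylor 2001, Thm. A, with Carayol), and,
for the given `W` and `K`: if `K` is imaginary quadratic and every prime dividing `N_W` splits in `K`,
there is a primitive quadratic Dirichlet character `χ` mod some `m` coprime to `N_W` with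
`aₙ(W^{(d_K)}) = χ(n) aₙ(W)` for all `n` and `χ(−1) χ(N_W) = −1` (the Kronecker character `χ_{d_K}`
mod `|d_K|`: `aₙ(E ⊗ χ_{d_K}) = χ_{d_K}(n) aₙ(E)`, `χ_{d_K}(−1) = −1` as `d_K < 0`, `χ_{d_K}(N) = 1` as
all `p ∣ N` split; Gross 1984, §5; Gross–Zagier 1986, IV (0.1); Darmon 2004, Thm. 3.17). Then
`one_le_analyticRankEK W N K`. [cite: Gross1984, §5] -/
theorem one_le_analyticRankEK_of_exists_isNewformOf_of_twistCharacter (hmod : exists_isNewformOf)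
    (hχ : ∀ [W.IsElliptic], IsImaginaryQuadratic K →
      SatisfiesHeegnerHypothesis (W.conductorNorm ℤ) K →
        ∃ (m : ℕ) (_ : NeZero m) (χ : DirichletCharacter ℂ m), (W.conductorNorm ℤ).Coprime m ∧
          χ.IsQuadratic ∧ χ.IsPrimitive ∧
          (∀ n : ℕ, ((W.quadraticTwist (NumberField.discr K : ℚ)).LFunction n : ℂ) =
            χ n * (W.LFunction n : ℂ)) ∧
          χ (-1) * χ (W.conductorNorm ℤ) = -1) :
    one_le_analyticRankEK W N K := by
  intro _ hK hN hH
  haveI : NeZero (W.conductorNorm ℤ) := ⟨(W.conductorNorm_pos_holds).ne'⟩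
  obtain ⟨f, hf⟩ := hmod W
  rw [← hN] at hH
  obtain ⟨m, _, χ, hNm, hq, hprim, hcoeff, hsign⟩ := hχ hK hH
  exact one_le_analyticRankEK_of_isNewformOf_of_cuspCoeff_twist W (W.conductorNorm ℤ) K hf hNm hq
    hprim hcoeff hsign

end Literature.NumberTheory.EllipticCurves

end
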